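import Literature.Topology.FourManifolds.LoopRealisation
import Literature.Topology.FourManifolds.FrameLoop
import Literature.Topology.FourManifolds.CerfTheoremOneProofs
import Literature.Topology.FourManifolds.DiffeotopyTransportProofs
import HarnessLib

/-!
# Cerf's Proposition 4 at `i = 0`, injectivity: Théorème 1 ⟹ `π₀(Diff(D³; S²)) = 0`

Cerf, *Sur les difféomorphismes de la sphère de dimension trois (Γ₄ = 0)*, LNM 53 (1968), Ch. I
§2, first sentence: « D'après la proposition 4 de l'Appendice, le théorème 1 **équivaut** à
(2) `π₀(Diff(D³; S²)) = 0` »; Appendice §5, Proposition 4: `π_i(Diff Sⁿ) ≈ π_i(𝒦) ⊕ π_i(SO(n+1))`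
for all `i ≥ 0`, `𝒦` the diffeomorphisms of `Dⁿ` infinitely tangent to the identity along `Sⁿ⁻¹`.
The tree had only one half of this equivalence at `i = 0`: `π₀(𝒦ₙ) = 0 ⟹ π₀(Diff⁺ Sⁿ) = 0`
(`CerfPropositionFour.lean`, `CerfTheoremOneProofs.lean`; in particular
`cerf_pi0DiffPlus_sphere_three_of_relBoundary`: (2) ⟹ Théorème 1). This file proves the other
half, the **monomorphism `π₀(𝒦ₙ) ↪ π₀(Diff Sⁿ)`**, for every `n`:

* `Literature.Topology.FourManifolds.compactDiffeotopyTrivial_of_forall_isDiffeotopicToId_of_eventuallyEq`: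
  if every diffeomorphism of `𝕊ⁿ` which is the identity near a point `v` is diffeotopic to the
  identity, then `π₀` of the compactly supported diffeomorphisms of `ℝⁿ` is trivial
  (`CompactDiffeotopyTrivial (EuclideanSpace ℝ (Fin n))`, `DiffeotopyTransport.lean`);
* `Literature.Topology.FourManifolds.compactDiffeotopyTrivial_of_forall_isDiffeotopicToId_of_isOrientationPreserving`:
  the same from `π₀(Diff⁺ Sⁿ) = 0` (every orientation-preserving diffeomorphism of `𝕊ⁿ` is
  diffeotopic to the identity), and `Literature.Topology.FourManifolds.unitBallDiffeotopyTrivial_iff_forall_isDiffeotopicToId`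
  (`n ≠ 0`): **`π₀(𝒦ₙ) = 0 ⟺ π₀(Diff⁺ Sⁿ) = 0`**, Cerf's Proposition 4 at `i = 0` as an `iff`;
* `Literature.Topology.FourManifolds.cerf_pi0DiffDisc_relBoundary_three_of_forall_isOrientationPreserving`,
  `…_iff_forall_isOrientationPreserving`, `…_of_pi0Diff`, `…_iff_pi0Diff`: **Théorème 1 as
  printed ⟹ (2)**; the named facts `cerf_pi0DiffDisc_relBoundary_three` and
  `cerf_pi0Diff_sphere_three` of the tree are equivalent, to each other and to Théorème 1 as
  printed, exactly as Cerf states.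

## Proof (the homotopy sequence of `𝒦 → Diff Sⁿ → Emb(Dⁿ, Sⁿ) ≃ SO(n+1)` made concrete)

Let `s` be a compactly supported diffeomorphism of `ℝⁿ`, `φ` its transport to `𝕊ⁿ` along the
stereographic chart `σ_v` from a pole `v` (`chartTransportDiffeomorph`; `φ = id` near `v`), and
`t ↦ D_t` a diffeotopy of `𝕊ⁿ` from `id` to `φ`, reparametrised to be stationary outside
`[0, 1]`. Cerf: the restriction of `D_t` to a disc around `v` is a loop in `Emb(Dⁿ, Sⁿ) ≃ SO(n+1)`,
which lifts to `SO(n+1) ⊂ Diff Sⁿ`, so the boundary map to `π₀(𝒦)` kills it. Concretely: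
1. (`FrameLoop.lean`) the Gram–Schmidt frame loop `A_t ∈ O(n+1)` of the `1`-jet of `D_t` at `v`
   is a smooth loop of isometries with `A_t v = D_t v`, and the corrected family
   `E_t = A_t⁻¹ ∘ D_t` fixes `v` with `1`-jet whose segments to the identity stay invertible
   (flag-positivity), read in the chart `σ_{-v}` centred at `v`;
2. (`LoopRealisation.lean`) the loop of germs of `E_t` at `v` is realised by a loop `L_t` of
   compactly supported diffeomorphisms of `ℝⁿ` (`L_t = e_t` near `0`, `L_1 = id`), transported
   back to a loop `L^S_t` of diffeomorphisms of `𝕊ⁿ` supported in a cap around `v`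
   (`Diffeotopy.chartTransport`);
3. `H_t = (L^S_t)⁻¹ ∘ A_t⁻¹ ∘ D_t` is a diffeotopy from `id` to `φ` **all of whose stages are the
   identity on a fixed cap around `v`**; conjugating by `σ_v` gives a compactly supported
   diffeotopy of `ℝⁿ` from `id` to `s`.

Everything is proved; no definitions, no new named facts (net debt unchanged; the two Cerf leaves
become provably equivalent).

## References

* J. Cerf, *Sur les difféomorphismes de la sphère de dimension trois (Γ₄ = 0)*, LNM 53 (1968),
  Ch. I §1 (Théorème 1), §2 (first sentence, statement (2)); Appendice §1 (Thm. 1), §5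
  (Propositions 3, 4). [CerfDiffeoSphere1968]
* M. W. Hirsch, *Differential Topology*, GTM 33 (1976), Ch. 8 §1, §3. [HirschDT1976]
-/

open scoped Manifold ContDiff Topology RealInnerProductSpace
open Function Set Filter Metric Module

noncomputable section

namespace Literature.Topology.FourManifolds

/-- Local notation: `𝔼 n` is the model Euclidean space `EuclideanSpace ℝ (Fin n)`. -/
local notation "𝔼 " n:arg => EuclideanSpace ℝ (Fin n)

/-- Local notation: `𝕊 n` is the unit sphere in `EuclideanSpace ℝ (Fin (n + 1))`. -/
local notation "𝕊 " n:arg => (Metric.sphere (0 : EuclideanSpace ℝ (Fin (n + 1))) 1)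

attribute [local instance] fact_finrank_euclideanSpace_succ

variable {n : ℕ}

/-! ## §1 Heights and chart radii for the two stereographic charts at `±v` -/

/-- Height of `σ_{-v}⁻¹ z` over the pole `v`: `⟪σ_{-v}⁻¹ z, v⟫ = (4 - ‖z‖²)/(4 + ‖z‖²)`
(Mathlib's normalisation of the stereographic projection). [folklore] -/
theorem inner_stereographic'_symm_neg_pole (v : 𝕊 n) (z : 𝔼 n) :
    ⟪((((stereographic' n (-v)).symm z : 𝕊 n)) : 𝔼 (n + 1)), (v : 𝔼 (n + 1))⟫ =
      (4 - ‖z‖ ^ 2) / (4 + ‖z‖ ^ 2) := by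
  have h := real_inner_stereographic'_symm_pole (-v) z
  rw [coe_neg_sphere, inner_neg_right] at h
  have h4 : (0 : ℝ) < ‖z‖ ^ 2 + 4 := by positivity
  rw [neg_eq_iff_eq_neg] at h
  rw [h]
  field_simp
  ring

/-- **Small chart radius at `v` means large height**: for `x ≠ -v`, if
`⟪x, v⟫ ≥ (4 - d)/(4 + d)` with `0 < d` then `‖σ_{-v} x‖² ≤ d`. [folklore] -/
theorem norm_sq_stereographic'_neg_le (v : 𝕊 n) {x : 𝕊 n} (hx : x ≠ -v) {d : ℝ} (hd : 0 < d)
    (h : (4 - d) / (4 + d) ≤ ⟪(x : 𝔼 (n + 1)), (v : 𝔼 (n + 1))⟫) :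
    ‖stereographic' n (-v) x‖ ^ 2 ≤ d := by
  set z := stereographic' n (-v) x with hz
  have hxz : (stereographic' n (-v)).symm z = x := stereographic'_symm_apply_of_ne (-v) hx
  have h1 : ⟪(x : 𝔼 (n + 1)), (v : 𝔼 (n + 1))⟫ = (4 - ‖z‖ ^ 2) / (4 + ‖z‖ ^ 2) := by
    rw [← hxz, inner_stereographic'_symm_neg_pole]
  rw [h1, div_le_div_iff₀ (by positivity) (by positivity)] at h
  nlinarith [sq_nonneg ‖z‖]

/-- **Large chart radius at `-v`... means large height over `v`**: if `‖y‖² · d ≥ 16` then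
`⟪σ_v⁻¹ y, v⟫ ≥ (4 - d)/(4 + d)`. [folklore] -/
theorem le_inner_stereographic'_symm_pole (v : 𝕊 n) {y : 𝔼 n} {d : ℝ} (hd : 0 < d)
    (hy : 16 ≤ ‖y‖ ^ 2 * d) :
    (4 - d) / (4 + d) ≤ ⟪((((stereographic' n v).symm y : 𝕊 n)) : 𝔼 (n + 1)), (v : 𝔼 (n + 1))⟫ := by
  rw [real_inner_stereographic'_symm_pole, div_le_div_iff₀ (by positivity) (by positivity)]
  nlinarith [sq_nonneg ‖y‖]

/-! ## §2 The cap-fixing diffeotopy -/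

/-- **From a diffeotopy of `𝕊ⁿ` ending at a diffeomorphism which is the identity near the pole
`v` to one all of whose stages are the identity near `v`.** Let `D` be a diffeotopy of `𝕊ⁿ`,
stationary outside `[0, 1]` (`D_t = id` for `t ≤ 0`, `D_t = D_1` for `t ≥ 1`) with `D_1 = id`
near `v`, and suppose `D_1` and all `D_t` ... (no further hypothesis). Then there is a diffeotopy
`H` of `𝕊ⁿ` with `H_1 = D_1` and a radius `δ > 0` such that every stage `H_t` fixes every point
`x ≠ -v` of the cap `‖σ_{-v} x‖ ≤ δ` around `v`. Steps 1–3 of the module docstring.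
[cite: CerfDiffeoSphere1968, Appendice §5, Prop. 4] -/
theorem exists_diffeotopy_fixing_cap (D : Diffeotopy (𝓡 n) (𝕊 n)) (v : 𝕊 n)
    (hD0 : ∀ t ≤ (0 : ℝ), D.toFun t = id) (hD1 : ∀ t, (1 : ℝ) ≤ t → D.toFun t = D.toFun 1)
    (hφ : ∀ᶠ z in 𝓝 v, D.toFun 1 z = z) :
    ∃ (H : Diffeotopy (𝓡 n) (𝕊 n)) (δ : ℝ), 0 < δ ∧ H.toFun 1 = D.toFun 1 ∧
      ∀ t (x : 𝕊 n), x ≠ -v → ‖stereographic' n (-v) x‖ ≤ δ → H.toFun t x = x := by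
  have hv0 : (v : 𝔼 (n + 1)) ≠ 0 := ne_zero_of_mem_unit_sphere v
  -- Step 1: the frame loop
  obtain ⟨A, hAs, hA0, hA1, hAv, hseg⟩ := exists_frameLoop D v hD0 hD1 hφ
  -- the isometry diffeotopy `t ↦ A t`
  have hAcl : ContDiff ℝ ∞ fun p : ℝ × 𝔼 (n + 1) => A p.1 p.2 :=
    (hAs.comp contDiff_fst).clm_apply contDiff_snd
  have hAunit : ∀ t, IsUnit (A t : 𝔼 (n + 1) →L[ℝ] 𝔼 (n + 1)) := fun t =>
    ContinuousLinearMap.isUnit_iff_bijective.mpr (A t).bijective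
  have hAinv : ∀ t y, Ring.inverse (A t : 𝔼 (n + 1) →L[ℝ] 𝔼 (n + 1)) y = (A t).symm y := by
    intro t y
    have h1 : Ring.inverse (A t : 𝔼 (n + 1) →L[ℝ] 𝔼 (n + 1)) * (A t : 𝔼 (n + 1) →L[ℝ] 𝔼 (n + 1)) =
        1 := Ring.inverse_mul_cancel _ (hAunit t)
    have h2 := congrArg (fun L : 𝔼 (n + 1) →L[ℝ] 𝔼 (n + 1) => L ((A t).symm y)) h1
    simp only [mul_apply_eq_comp, one_apply_eq_self] at h2
    rw [← h2]
    congr 1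
    exact ((A t).apply_symm_apply y).symm
  have hAcl' : ContDiff ℝ ∞ fun p : ℝ × 𝔼 (n + 1) => (A p.1).symm p.2 := by
    have h1 : ContDiff ℝ ∞ fun t => Ring.inverse (A t : 𝔼 (n + 1) →L[ℝ] 𝔼 (n + 1)) := by
      rw [contDiff_iff_contDiffAt]
      intro t
      have h3 : ContDiffAt ℝ ∞ Ring.inverse (A t : 𝔼 (n + 1) →L[ℝ] 𝔼 (n + 1)) := by
        have := contDiffAt_ringInverse ℝ (n := ∞) (hAunit t).unit
        rwa [(hAunit t).unit_spec] at this
      exact h3.comp t hAs.contDiffAt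
    have h2 : ContDiff ℝ ∞ fun p : ℝ × 𝔼 (n + 1) =>
        Ring.inverse (A p.1 : 𝔼 (n + 1) →L[ℝ] 𝔼 (n + 1)) p.2 :=
      (h1.comp contDiff_fst).clm_apply contDiff_snd
    have hfun : (fun p : ℝ × 𝔼 (n + 1) => (A p.1).symm p.2) =
        fun p => Ring.inverse (A p.1 : 𝔼 (n + 1) →L[ℝ] 𝔼 (n + 1)) p.2 :=
      funext fun p => (hAinv p.1 p.2).symm
    rw [hfun]
    exact h2
  obtain ⟨Ah, hAh_inv⟩ : ∃ Ah : Diffeotopy (𝓡 n) (𝕊 n),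
      ∀ t x, Ah.invFun t x = sphereCongr (A t).symm x := by
    refine ⟨Diffeotopy.ofLinearIsometryFamily A hAcl hAcl' (hA0 0 le_rfl), fun t x => ?_⟩
    rw [← Diffeotopy.coe_stage_symm, Diffeotopy.ofLinearIsometryFamily_stage, sphereCongr_symm]
  obtain ⟨Ed, hEd_toFun⟩ : ∃ Ed : Diffeotopy (𝓡 n) (𝕊 n),
      ∀ t x, Ed.toFun t x = sphereCongr (A t).symm (D.toFun t x) :=
    ⟨D.trans Ah.inv, fun t x => by
      rw [Diffeotopy.trans_toFun, comp_apply, Diffeotopy.inv_toFun, hAh_inv]⟩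
  have hEd_v : ∀ t, Ed.toFun t v = v := by
    intro t
    rw [hEd_toFun]
    apply Subtype.ext
    rw [coe_sphereCongr, ← hAv t, LinearIsometryEquiv.symm_apply_apply]
  have hEd0 : ∀ t ≤ (0 : ℝ), Ed.toFun t = id := by
    intro t ht
    funext x
    rw [hEd_toFun, hD0 t ht, hA0 t ht, id]
    apply Subtype.ext
    rw [coe_sphereCongr]
    rfl
  have hEd1 : ∀ t, (1 : ℝ) ≤ t → Ed.toFun t = D.toFun 1 := by
    intro t ht
    funext x
    rw [hEd_toFun, hD1 t ht, hA1 t ht]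
    apply Subtype.ext
    rw [coe_sphereCongr]
    rfl
  -- the chart `κ = σ_{-v}` centred at `v`
  set κ := stereographic' n (-v) with hκ
  have hκc : ContMDiffOn (𝓡 n) (𝓡 n) ∞ κ κ.source := by
    rw [hκ, stereographic'_source]; exact contMDiffOn_stereographic' (-v)
  have hκt : κ.target = univ := by rw [hκ, stereographic'_target]
  have hκs : κ.source = {-v}ᶜ := by rw [hκ, stereographic'_source]
  have hκ' : ContMDiff (𝓡 n) (𝓡 n) ∞ κ.symm := contMDiff_stereographic'_symm (-v)
  have hκ0 : κ.symm 0 = v := by rw [hκ, stereographic'_symm_zero, neg_neg]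
  have hκv : κ v = 0 := by
    have h1 : κ (κ.symm 0) = 0 := stereographic'_stereographic'_symm (-v) 0
    rwa [hκ0] at h1
  have hleft : ∀ x : 𝕊 n, x ≠ -v → κ.symm (κ x) = x := fun x hx =>
    κ.left_inv (by rw [hκs]; exact hx)
  have hright : ∀ y : 𝔼 n, κ (κ.symm y) = y := fun y => κ.right_inv (by rw [hκt]; trivial)
  have hsymm_ne : ∀ y : 𝔼 n, κ.symm y ≠ -v := fun y => stereographic'_symm_ne (-v) y
  -- the chart family `e t = κ ∘ E_t ∘ κ⁻¹`
  set e : ℝ → 𝔼 n → 𝔼 n := fun t y => κ (Ed.toFun t (κ.symm y)) with he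
  have he_eq : ∀ t, e t = fun y : 𝔼 n =>
      stereographic' n (-v) (sphereCongr (A t).symm (D.toFun t ((stereographic' n (-v)).symm y))) := by
    intro t; funext y; simp only [he, hEd_toFun, hκ]
  -- a uniform radius on which `E_t ∘ κ⁻¹` avoids `-v`, and on which `D_1 = id`
  obtain ⟨r₀, hr₀, hr₀ne, hr₀id⟩ : ∃ r₀ > (0 : ℝ),
      (∀ t, ∀ y ∈ ball (0 : 𝔼 n) r₀, Ed.toFun t (κ.symm y) ≠ -v) ∧
      (∀ y ∈ ball (0 : 𝔼 n) r₀, D.toFun 1 (κ.symm y) = κ.symm y) := by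
    -- the set where the family avoids `-v` is open and contains `[0, 1] × {0}`
    have hcont : Continuous fun q : ℝ × 𝔼 n => Ed.toFun q.1 (κ.symm q.2) :=
      Ed.contMDiff_uncurry_toFun.continuous.comp
        (continuous_fst.prodMk (hκ'.continuous.comp continuous_snd))
    set W : Set (ℝ × 𝔼 n) := (fun q : ℝ × 𝔼 n => Ed.toFun q.1 (κ.symm q.2)) ⁻¹' {-v}ᶜ with hW
    have hWo : IsOpen W := (isOpen_compl_singleton).preimage hcont
    have hsub : Icc (0 : ℝ) 1 ×ˢ ({0} : Set (𝔼 n)) ⊆ W := by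
      rintro ⟨t, y⟩ ⟨-, hy⟩
      rw [mem_singleton_iff] at hy
      subst hy
      show Ed.toFun t (κ.symm 0) ∈ ({-v}ᶜ : Set (𝕊 n))
      rw [hκ0, hEd_v, mem_compl_singleton_iff]
      exact fun h => ne_neg_of_mem_unit_sphere ℝ v h
    obtain ⟨u, w, -, hw, hIu, h0w, huw⟩ :=
      generalized_tube_lemma isCompact_Icc isCompact_singleton hWo hsub
    obtain ⟨r₁, hr₁, hr₁w⟩ := Metric.isOpen_iff.mp hw 0 (h0w rfl)
    -- the neighbourhood of `v` where `D_1 = id`, pulled back by `κ⁻¹`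
    have hpull : ∀ᶠ y in 𝓝 (0 : 𝔼 n), D.toFun 1 (κ.symm y) = κ.symm y := by
      have hc : ContinuousAt κ.symm 0 := hκ'.continuous.continuousAt
      rw [← hκ0] at hφ
      exact hc.eventually hφ
    obtain ⟨r₂, hr₂, hr₂b⟩ := Metric.eventually_nhds_iff_ball.mp hpull
    refine ⟨min r₁ r₂, lt_min hr₁ hr₂, fun t y hy => ?_, fun y hy => hr₂b y ?_⟩
    · have hy₁ : y ∈ ball (0 : 𝔼 n) r₁ := ball_subset_ball (min_le_left _ _) hy
      have hy₂ : y ∈ ball (0 : 𝔼 n) r₂ := ball_subset_ball (min_le_right _ _) hy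
      by_cases ht : t ∈ Icc (0 : ℝ) 1
      · have hmem : ((t, y) : ℝ × 𝔼 n) ∈ W := huw ⟨hIu ht, hr₁w hy₁⟩
        exact hmem
      · rw [mem_Icc, not_and_or, not_le, not_le] at ht
        rcases ht with ht | ht
        · rw [hEd0 t ht.le, id]
          exact hsymm_ne y
        · rw [hEd1 t ht.le, hr₂b y hy₂]
          exact hsymm_ne y
    · exact ball_subset_ball (min_le_right _ _) hy
  -- hypotheses of the loop realisation theorem for `e`
  have he_smooth : ContDiffOn ℝ ∞ (uncurry e) (univ ×ˢ ball (0 : 𝔼 n) r₀) := by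
    have h1 : ContMDiff (𝓘(ℝ, ℝ).prod 𝓘(ℝ, 𝔼 n)) (𝓡 n) ∞
        fun q : ℝ × 𝔼 n => Ed.toFun q.1 (κ.symm q.2) :=
      Ed.contMDiff_uncurry_toFun.comp (contMDiff_fst.prodMk (hκ'.comp contMDiff_snd))
    have h2 : ContMDiffOn (𝓘(ℝ, ℝ).prod 𝓘(ℝ, 𝔼 n)) (𝓡 n) ∞
        (κ ∘ fun q : ℝ × 𝔼 n => Ed.toFun q.1 (κ.symm q.2)) (univ ×ˢ ball (0 : 𝔼 n) r₀) := by
      refine hκc.comp h1.contMDiffOn ?_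
      rintro ⟨t, y⟩ ⟨-, hy⟩
      show Ed.toFun t (κ.symm y) ∈ κ.source
      rw [hκs]
      exact hr₀ne t y hy
    rw [← modelWithCornersSelf_prod, chartedSpaceSelf_prod] at h2
    exact (contMDiffOn_iff_contDiffOn.mp h2).congr fun q _ => rfl
  have he0 : ∀ t, e t 0 = 0 := fun t => by
    simp only [he, hκ0, hEd_v, hκv]
  have hst0 : ∀ t ≤ (0 : ℝ), ∀ y ∈ ball (0 : 𝔼 n) r₀, e t y = y := fun t ht y _ => by
    simp only [he, hEd0 t ht, id, hright]
  have hst1 : ∀ t, (1 : ℝ) ≤ t → ∀ y ∈ ball (0 : 𝔼 n) r₀, e t y = y := fun t ht y hy => by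
    simp only [he, hEd1 t ht, hr₀id y hy, hright]
  have hsegE : ∀ t ∈ Icc (0 : ℝ) 1, ∀ s ∈ Icc (0 : ℝ) 1,
      IsUnit ((1 - s) • fderiv ℝ (e t) 0 + s • (1 : 𝔼 n →L[ℝ] 𝔼 n)) := fun t _ s hs => by
    rw [he_eq t]; exact hseg t s hs
  -- Step 2: loop realisation, transported back to the sphere
  obtain ⟨L, δ, hδ, hL1, hL2, hL3⟩ :=
    exists_diffeotopy_loopRealisation hr₀ he_smooth he0 hst0 hst1 hsegE one_pos
  obtain ⟨LS, hLS_toFun⟩ : ∃ LS : Diffeotopy (𝓡 n) (𝕊 n),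
      ∀ t x, LS.toFun t x = chartTransport κ (L.toFun t) x :=
    ⟨L.chartTransport hκc hκ' hκt hL2, fun t x => rfl⟩
  -- Step 3: the cap-fixing diffeotopy `H_t = (L^S_t)⁻¹ ∘ E_t`
  set δ' : ℝ := min δ (r₀ / 2) with hδ'
  have hδ'0 : 0 < δ' := lt_min hδ (by positivity)
  refine ⟨Ed.trans LS.inv, δ', hδ'0, ?_, fun t x hx hxδ => ?_⟩
  · -- `H_1 = D_1`
    funext x
    rw [Diffeotopy.trans_toFun, comp_apply, Diffeotopy.inv_toFun, hEd1 1 le_rfl]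
    have h1 : LS.toFun 1 = id := by
      funext y
      rw [hLS_toFun, hL3 1 (Or.inr le_rfl), chartTransport_id_eq]
    have h3 := LS.invFun_toFun 1 (D.toFun 1 x)
    rw [h1] at h3
    exact h3
  · -- every stage fixes the cap `‖κ x‖ ≤ δ'`, `x ≠ -v`
    have hxs : x ∈ κ.source := by rw [hκs]; exact hx
    have hκx : κ x ∈ ball (0 : 𝔼 n) r₀ := by
      rw [mem_ball, dist_zero_right]
      have : δ' ≤ r₀ / 2 := min_le_right _ _
      linarith
    have hκx' : κ x ∈ closedBall (0 : 𝔼 n) δ := by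
      rw [mem_closedBall, dist_zero_right]
      exact hxδ.trans (min_le_left _ _)
    have hne : Ed.toFun t x ≠ -v := by
      have := hr₀ne t (κ x) hκx
      rwa [hleft x hx] at this
    have hLSx : LS.toFun t x = Ed.toFun t x := by
      rw [hLS_toFun, chartTransport_of_mem _ hxs, hL1 t _ hκx']
      simp only [he, hleft x hx, hleft _ hne]
    rw [Diffeotopy.trans_toFun, comp_apply, Diffeotopy.inv_toFun, ← hLSx]
    exact LS.invFun_toFun t x

/-! ## §3 From the cap-fixing diffeotopy to a compactly supported diffeotopy of `ℝⁿ` -/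

/-- **A diffeotopy of `𝕊ⁿ` whose stages fix a cap around `v` reads, in the stereographic chart
`σ_v` from the pole `v`, as a compactly supported diffeotopy of `ℝⁿ`** (stages
`σ_v ∘ H_t ∘ σ_v⁻¹`, supported in `B̄(0, 4/δ)` if the cap is `‖σ_{-v} x‖ ≤ δ`). The passage
`𝒦 ← Diff(Sⁿ rel cap)` of Cerf's Proposition 4. [cite: CerfDiffeoSphere1968, Appendice §5, Prop. 4] -/
theorem exists_compactDiffeotopy_of_fixing_cap (v : 𝕊 n) (H : Diffeotopy (𝓡 n) (𝕊 n)) {δ : ℝ}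
    (hδ : 0 < δ)
    (hcap : ∀ t (x : 𝕊 n), x ≠ -v → ‖stereographic' n (-v) x‖ ≤ δ → H.toFun t x = x) :
    ∃ G : Diffeotopy 𝓘(ℝ, 𝔼 n) (𝔼 n),
      (∀ t y, G.toFun t y = stereographic' n v (H.toFun t ((stereographic' n v).symm y))) ∧
      ∀ t y, 4 / δ ≤ ‖y‖ → G.toFun t y = y := by
  set σ := stereographic' n v with hσ
  have hσc : ContMDiffOn (𝓡 n) (𝓡 n) ∞ σ σ.source := by
    rw [hσ, stereographic'_source]; exact contMDiffOn_stereographic' v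
  have hσt : σ.target = univ := by rw [hσ, stereographic'_target]
  have hσs : σ.source = {v}ᶜ := by rw [hσ, stereographic'_source]
  have hσ' : ContMDiff (𝓡 n) (𝓡 n) ∞ σ.symm := contMDiff_stereographic'_symm v
  have hsymm_ne : ∀ y : 𝔼 n, σ.symm y ≠ v := fun y => stereographic'_symm_ne v y
  have hleft : ∀ x : 𝕊 n, x ≠ v → σ.symm (σ x) = x := fun x hx =>
    σ.left_inv (by rw [hσs]; exact hx)
  have hright : ∀ y : 𝔼 n, σ (σ.symm y) = y := fun y => σ.right_inv (by rw [hσt]; trivial)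
  -- the stages fix `v`, hence map `{v}ᶜ` to itself
  have hv : v ≠ -v := fun h => ne_neg_of_mem_unit_sphere ℝ v h
  have hκv : ‖stereographic' n (-v) v‖ ≤ δ := by
    have h0 : (stereographic' n (-v)).symm 0 = v := by rw [stereographic'_symm_zero, neg_neg]
    have h1 : stereographic' n (-v) ((stereographic' n (-v)).symm 0) = 0 :=
      stereographic'_stereographic'_symm (-v) 0
    rw [h0] at h1
    rw [h1, norm_zero]; exact hδ.le
  have hHv : ∀ t, H.toFun t v = v := fun t => hcap t v hv hκv
  have hHv' : ∀ t, H.invFun t v = v := fun t => by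
    have h1 := H.invFun_toFun t v
    rw [hHv t] at h1
    exact h1
  have hHne : ∀ t (x : 𝕊 n), x ≠ v → H.toFun t x ≠ v := fun t x hx h =>
    hx (by rw [← H.invFun_toFun t x, h, hHv'])
  have hHne' : ∀ t (x : 𝕊 n), x ≠ v → H.invFun t x ≠ v := fun t x hx h =>
    hx (by rw [← H.toFun_invFun t x, h, hHv])
  -- joint smoothness of the transported families
  have hsm : ∀ F : ℝ → (𝕊 n) → 𝕊 n, ContMDiff (𝓘(ℝ, ℝ).prod (𝓡 n)) (𝓡 n) ∞ (uncurry F) →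
      (∀ t x, x ≠ v → F t x ≠ v) →
      ContMDiff (𝓘(ℝ, ℝ).prod 𝓘(ℝ, 𝔼 n)) 𝓘(ℝ, 𝔼 n) ∞
        (uncurry fun t (y : 𝔼 n) => σ (F t (σ.symm y))) := by
    intro F hF hFne
    have h1 : ContMDiff (𝓘(ℝ, ℝ).prod 𝓘(ℝ, 𝔼 n)) (𝓡 n) ∞
        fun q : ℝ × 𝔼 n => F q.1 (σ.symm q.2) :=
      hF.comp (contMDiff_fst.prodMk (hσ'.comp contMDiff_snd))
    refine hσc.comp_contMDiff h1 fun q => ?_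
    rw [hσs]
    exact hFne q.1 _ (hsymm_ne q.2)
  refine ⟨Diffeotopy.mk' 𝓘(ℝ, 𝔼 n) (fun t (y : 𝔼 n) => σ (H.toFun t (σ.symm y)))
    (fun t (y : 𝔼 n) => σ (H.invFun t (σ.symm y)))
    (hsm H.toFun H.contMDiff_uncurry_toFun hHne) (hsm H.invFun H.contMDiff_uncurry_invFun hHne')
    (fun t y => ?_) (fun t y => ?_) ?_, fun t y => rfl, fun t y hy => ?_⟩
  · show σ (H.invFun t (σ.symm (σ (H.toFun t (σ.symm y))))) = y
    rw [hleft _ (hHne t _ (hsymm_ne y)), H.invFun_toFun, hright]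
  · show σ (H.toFun t (σ.symm (σ (H.invFun t (σ.symm y))))) = y
    rw [hleft _ (hHne' t _ (hsymm_ne y)), H.toFun_invFun, hright]
  · funext y
    show σ (H.toFun 0 (σ.symm y)) = id y
    rw [H.toFun_zero, id, id, hright]
  show σ (H.toFun t (σ.symm y)) = y
  have hy0 : 0 < ‖y‖ := lt_of_lt_of_le (by positivity) hy
  have hx : σ.symm y ≠ -v := by
    intro h
    have h0 : σ.symm 0 = -v := stereographic'_symm_zero v
    have : y = 0 := by
      have := σ.symm.injOn (by rw [σ.symm_source, hσt]; trivial)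
        (by rw [σ.symm_source, hσt]; trivial) (h.trans h0.symm)
      exact this
    rw [this, norm_zero] at hy0
    exact lt_irrefl _ hy0
  have hheight : (4 - δ ^ 2) / (4 + δ ^ 2) ≤
      ⟪(((σ.symm y : 𝕊 n)) : 𝔼 (n + 1)), (v : 𝔼 (n + 1))⟫ := by
    refine le_inner_stereographic'_symm_pole v (by positivity) ?_
    have h1 : 4 ≤ ‖y‖ * δ := by rwa [div_le_iff₀ hδ] at hy
    nlinarith [h1, norm_nonneg y, hδ.le]
  have hcapx : ‖stereographic' n (-v) (σ.symm y)‖ ≤ δ := by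
    have h1 := norm_sq_stereographic'_neg_le v hx (by positivity) hheight
    exact (pow_le_pow_iff_left₀ (norm_nonneg _) hδ.le two_ne_zero).mp h1
  rw [hcap t _ hx hcapx, hright]

/-! ## §4 Proposition 4 at `i = 0`, injectivity -/

/-- **Cerf (1968), Appendice, Proposition 4 at `i = 0`, injectivity half `π₀(𝒦ₙ) ↪ π₀(Diff Sⁿ)`.**
If every diffeomorphism of `𝕊ⁿ` which is the identity on a neighbourhood of the point `v` is
diffeotopic to the identity (through arbitrary diffeomorphisms of `𝕊ⁿ`), then every compactly
supported diffeomorphism of `ℝⁿ` is compactly diffeotopic to the identity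
(`CompactDiffeotopyTrivial`). Proof: module docstring, steps 1–3
(`exists_diffeotopy_fixing_cap`, `exists_compactDiffeotopy_of_fixing_cap`), applied to the
transport `φ` of `s` along `σ_v` and a diffeotopy `id ~ φ` reparametrised to be stationary
outside `[0, 1]`. Cerf derives this from the homotopy sequence of the fibration
`Diff Sⁿ → Emb(Dⁿ, Sⁿ)` (Appendice §1, Thm. 1) and `Emb(Dⁿ, Sⁿ) ≃ SO(n+1)` (Prop. 3).
[cite: CerfDiffeoSphere1968, Appendice §5, Prop. 4] -/
theorem compactDiffeotopyTrivial_of_forall_isDiffeotopicToId_of_eventuallyEq (v : 𝕊 n)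
    (h : ∀ φ : (𝕊 n) ≃ₘ⟮𝓡 n, 𝓡 n⟯ (𝕊 n), (∀ᶠ x in 𝓝 v, φ x = x) →
      Diffeomorph.IsDiffeotopicToId φ) :
    CompactDiffeotopyTrivial (𝔼 n) := by
  intro s R hs
  set σ := stereographic' n v with hσ
  have hσc : ContMDiffOn (𝓡 n) (𝓡 n) ∞ σ σ.source := by
    rw [hσ, stereographic'_source]; exact contMDiffOn_stereographic' v
  have hσt : σ.target = univ := by rw [hσ, stereographic'_target]
  have hσ' : ContMDiff (𝓡 n) (𝓡 n) ∞ σ.symm := contMDiff_stereographic'_symm v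
  set φ := chartTransportDiffeomorph hσc hσ' hσt s hs with hφ
  -- `φ = id` near `v`
  have hφv : ∀ᶠ x in 𝓝 v, φ x = x := by
    have hK : IsClosed (σ.symm '' closedBall (0 : 𝔼 n) R) :=
      ((isCompact_closedBall (0 : 𝔼 n) R).image hσ'.continuous).isClosed
    have hvK : v ∉ σ.symm '' closedBall (0 : 𝔼 n) R := by
      rintro ⟨y, -, hy⟩
      exact stereographic'_symm_ne v y hy
    filter_upwards [hK.isOpen_compl.mem_nhds hvK] with x hx
    exact chartTransportDiffeomorph_eq_self hσc hσ' hσt s hs hx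
  -- a diffeotopy `id ~ φ`, reparametrised to be stationary outside `[0, 1]`
  obtain ⟨D₀, hD₀⟩ := h φ hφv
  set D := D₀.reparam Real.smoothTransition Real.smoothTransition.contDiff
    (Real.smoothTransition.zero_of_nonpos le_rfl) with hD
  have hD_toFun : ∀ t, D.toFun t = D₀.toFun (Real.smoothTransition t) := fun t => rfl
  have hD0 : ∀ t ≤ (0 : ℝ), D.toFun t = id := fun t ht => by
    rw [hD_toFun, Real.smoothTransition.zero_of_nonpos ht, D₀.toFun_zero]
  have hD1 : ∀ t, (1 : ℝ) ≤ t → D.toFun t = D.toFun 1 := fun t ht => by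
    rw [hD_toFun, hD_toFun, Real.smoothTransition.one_of_one_le ht,
      Real.smoothTransition.one_of_one_le le_rfl]
  have hDφ : D.toFun 1 = ⇑φ := by
    rw [hD_toFun, Real.smoothTransition.one_of_one_le le_rfl, ← Diffeotopy.coe_stage, hD₀]
  have hφ' : ∀ᶠ z in 𝓝 v, D.toFun 1 z = z := by
    rw [hDφ]; exact hφv
  -- steps 1–3
  obtain ⟨H, δ, hδ, hH1, hcap⟩ := exists_diffeotopy_fixing_cap D v hD0 hD1 hφ'
  obtain ⟨G, hG, hGsupp⟩ := exists_compactDiffeotopy_of_fixing_cap v H hδ hcap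
  refine ⟨G, Diffeomorph.ext fun y => ?_, 4 / δ, hGsupp⟩
  rw [Diffeotopy.coe_stage, hG, hH1, hDφ, hφ, chartTransportDiffeomorph_symm_apply]
  exact (stereographic' n v).right_inv (by rw [stereographic'_target]; trivial)

/-- **`π₀(Diff⁺ Sⁿ) = 0 ⟹ π₀(𝒦ₙ) = 0`** (Cerf's Proposition 4 at `i = 0`, injectivity, in the
printed oriented reading): if every orientation-preserving diffeomorphism of `𝕊ⁿ` (`n ≠ 0`) is
diffeotopic to the identity, then `π₀` of the compactly supported diffeomorphisms of `ℝⁿ` is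
trivial. A diffeomorphism equal to the identity near a point cannot reverse an orientation
(its differential there is the identity), so the previous theorem applies.
[cite: CerfDiffeoSphere1968, Appendice §5, Prop. 4; Ch. I §2, first sentence] -/
theorem compactDiffeotopyTrivial_of_forall_isDiffeotopicToId_of_isOrientationPreserving
    (hn : n ≠ 0)
    (h : ∀ (o : SmoothOrientation (𝓡 n) (𝕊 n)) (φ : (𝕊 n) ≃ₘ⟮𝓡 n, 𝓡 n⟯ (𝕊 n)),
      φ.IsOrientationPreserving o o → Diffeomorph.IsDiffeotopicToId φ) :
    CompactDiffeotopyTrivial (𝔼 n) := by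
  -- `𝕊ⁿ`, `n ≠ 0`, is connected (as in `HomotopySphere.connectedSpace_sphere`,
  -- `HomotopySpheresGroup.lean`, not imported here)
  haveI : ConnectedSpace (𝕊 n) := by
    refine isConnected_iff_connectedSpace.mp (isConnected_sphere ?_ 0 zero_le_one)
    rw [← Module.finrank_eq_rank, finrank_euclideanSpace_fin]
    exact Nat.one_lt_cast.mpr (by omega)
  obtain ⟨o⟩ := isOrientable_sphere_holds n
  refine compactDiffeotopyTrivial_of_forall_isDiffeotopicToId_of_eventuallyEq (sphereBasePoint n)
    fun φ hφ => ?_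
  rcases Diffeomorph.isOrientationPreserving_or_isOrientationReversing_holds φ (by simp) o o
    with hp | hr
  · exact h o φ hp
  · exfalso
    have hv : φ (sphereBasePoint n) = sphereBasePoint n :=
      Filter.Eventually.self_of_nhds (p := fun x => φ x = x) hφ
    have hφ' : (⇑φ : (𝕊 n) → 𝕊 n) =ᶠ[𝓝 (sphereBasePoint n)] id := hφ
    have hd : mfderiv (𝓡 n) (𝓡 n) φ (sphereBasePoint n) =
        ContinuousLinearMap.id ℝ (TangentSpace (𝓡 n) (sphereBasePoint n)) := by
      rw [hφ'.mfderiv_eq]; exact mfderiv_id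
    have h1 := (hr (sphereBasePoint n)).mpr (by
      rw [hd]
      exact lt_of_lt_of_eq zero_lt_one LinearMap.det_id.symm)
    rw [hv, SmoothOrientation.neg_apply] at h1
    exact (Module.Ray.ne_neg_self (o (sphereBasePoint n))) h1.symm

/-- **Cerf's Proposition 4 at `i = 0` as an `iff`** (`n ≠ 0`): `π₀` of the diffeomorphisms of `ℝⁿ`
supported in the unit ball (with unit-ball supported diffeotopies) is trivial **iff** every
orientation-preserving diffeomorphism of `𝕊ⁿ` is diffeotopic to the identity —
`π₀(Diff(Dⁿ; Sⁿ⁻¹)) = 0 ⟺ π₀(Diff⁺ Sⁿ) = 0`. The forward direction is the tree's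
`Diffeomorph.isDiffeotopicToId_of_isOrientationPreserving_of_unitBallDiffeotopyTrivial`
(`CerfTheoremOneProofs.lean`); the converse is the present file with
`UnitBallDiffeotopyTrivial.of_compact`. [cite: CerfDiffeoSphere1968, Appendice §5, Prop. 4] -/
theorem unitBallDiffeotopyTrivial_iff_forall_isDiffeotopicToId (hn : n ≠ 0) :
    UnitBallDiffeotopyTrivial (𝔼 n) ↔
      ∀ (o : SmoothOrientation (𝓡 n) (𝕊 n)) (φ : (𝕊 n) ≃ₘ⟮𝓡 n, 𝓡 n⟯ (𝕊 n)),
        φ.IsOrientationPreserving o o → Diffeomorph.IsDiffeotopicToId φ :=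
  ⟨fun hK o φ hφ =>
    Diffeomorph.isDiffeotopicToId_of_isOrientationPreserving_of_unitBallDiffeotopyTrivial hn hK o φ
      hφ,
    fun h => UnitBallDiffeotopyTrivial.of_compact
      (compactDiffeotopyTrivial_of_forall_isDiffeotopicToId_of_isOrientationPreserving hn h)⟩

/-! ## §5 Cerf, Ch. I §2: « le théorème 1 équivaut à (2) » -/

/-- **Cerf (1968), Ch. I §2, first sentence, the direction missing from the tree: Théorème 1 as
printed (`π₀(Diff⁺ S³) = 0`: every orientation-preserving self-diffeomorphism of `𝕊³` is
diffeotopic to the identity) implies statement (2) `π₀(Diff(D³; S²)) = 0`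
(`cerf_pi0DiffDisc_relBoundary_three`).** The converse is
`isDiffeotopicToId_of_isOrientationPreserving_of_relBoundary` (`CerfTheoremOneProofs.lean`).
[cite: CerfDiffeoSphere1968, Ch. I §2, first sentence; Appendice §5, Prop. 4] -/
theorem cerf_pi0DiffDisc_relBoundary_three_of_forall_isOrientationPreserving
    (h : ∀ (o : SmoothOrientation (𝓡 3) (𝕊 3)) (φ : (𝕊 3) ≃ₘ⟮𝓡 3, 𝓡 3⟯ (𝕊 3)),
      φ.IsOrientationPreserving o o → Diffeomorph.IsDiffeotopicToId φ) :
    cerf_pi0DiffDisc_relBoundary_three :=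
  (cerf_pi0DiffDisc_relBoundary_three_iff).mpr
    ((unitBallDiffeotopyTrivial_iff_forall_isDiffeotopicToId three_ne_zero).mpr h)

/-- **Cerf (1968), Ch. I §2: « le théorème 1 équivaut à (2) ».** Statement (2)
(`cerf_pi0DiffDisc_relBoundary_three`, `π₀(𝒦₃) = 0`) holds iff every orientation-preserving
self-diffeomorphism of `𝕊³` is diffeotopic to the identity (Théorème 1 as printed).
[cite: CerfDiffeoSphere1968, Ch. I §2, first sentence; Appendice §5, Prop. 4] -/
theorem cerf_pi0DiffDisc_relBoundary_three_iff_forall_isOrientationPreserving :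
    cerf_pi0DiffDisc_relBoundary_three ↔
      ∀ (o : SmoothOrientation (𝓡 3) (𝕊 3)) (φ : (𝕊 3) ≃ₘ⟮𝓡 3, 𝓡 3⟯ (𝕊 3)),
        φ.IsOrientationPreserving o o → Diffeomorph.IsDiffeotopicToId φ :=
  ⟨isDiffeotopicToId_of_isOrientationPreserving_of_relBoundary,
    cerf_pi0DiffDisc_relBoundary_three_of_forall_isOrientationPreserving⟩

/-- **Théorème 1 in the tree's orientation-free form** (`cerf_pi0Diff_sphere_three`,
`RadialExtension.lean`: every diffeomorphism of `S³` is diffeotopic to the identity or to a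
hyperplane reflection) **implies (2).** [cite: CerfDiffeoSphere1968, Ch. I §2, first sentence] -/
theorem cerf_pi0DiffDisc_relBoundary_three_of_pi0Diff (h : cerf_pi0Diff_sphere_three) :
    cerf_pi0DiffDisc_relBoundary_three :=
  cerf_pi0DiffDisc_relBoundary_three_of_forall_isOrientationPreserving
    ((cerf_pi0Diff_sphere_three_iff_forall_isOrientationPreserving).mp h)

/-- **The two Cerf named facts `cerf_pi0DiffDisc_relBoundary_three` (statement (2)) and
`cerf_pi0Diff_sphere_three` (Théorème 1) of the tree are equivalent**, exactly as Cerf states in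
Ch. I §2; either one is the single unproved leaf of the Cerf cone.
[cite: CerfDiffeoSphere1968, Ch. I §2, first sentence; Appendice §5, Prop. 4] -/
theorem cerf_pi0DiffDisc_relBoundary_three_iff_pi0Diff :
    cerf_pi0DiffDisc_relBoundary_three ↔ cerf_pi0Diff_sphere_three :=
  ⟨cerf_pi0Diff_sphere_three_of_relBoundary, cerf_pi0DiffDisc_relBoundary_three_of_pi0Diff⟩

end Literature.Topology.FourManifolds
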